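import Summits.HodgeConjecture.HodgeConjecture.Theorems.Ring2AbelianAllAndreHomNumUnconditional
import Summits.HodgeConjecture.HodgeConjecture.Theorems.Ring2AbelianAllAndreFibreClassPrimitiveParts
import Literature.AlgebraicGeometry.HodgeTheory.InvariantClassesFromTotalSpaceHolds
import HarnessLib

/-!
# Ring 2 · sub-cell AbelianAll (ALL ABELIAN VARIETIES), André axis, part XXI-a — `B_min` LIVES ON THE PRIMITIVE
# INVARIANT ALGEBRAIC CLASSES: the lift (L)_t in degree `2p` follows from the lift in degree `2p - 2` and the lift of
# the monodromy-invariant, `κ`-PRIMITIVE, algebraic classes of degree `2p` on the fibre; hence the whole lift at `t`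
# reduces to finitely many primitive degrees `4 ≤ 2r ≤ d` (Kleiman's `A` below `r` granted — unconditional for `r = 2`),
# and (L)_t(2) ⟺ (Prim)_t(2) on EVERY compact pencil of abelian varieties, unconditionally

HONEST FRAMING (page 1, verbatim): **research route, not a corollary; conditional on HC_CM plus one named
minimal statement.** Cell line: research route conditional on HC_CM; not a corollary; Q11.4-sentence-2
already refuted in dim ≥ 3. Nothing in this file proves a case of the Hodge conjecture for an abelian variety;
`HC_CM` does not occur in this file (the `HC_CM` / node-level rows are part XXI-b). Seat `pub-hodge-ring2-ab-andre-2`,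
gen 13; brief (ii) "minimise: replace B by algebraicity of specific Lefschetz components" and (iii) "smallest open instance
stated as a find-the-cycle problem; partial results as theorems".

## The argument (one compact pencil `f : 𝒳 ⟶ S` of abelian `d`-folds, a point `t`, `j = j_t : X_t ↪ 𝒳`)

Notation: `N^p(Y) = algebraicClasses Y p`; `I = Im j^*` (the invariant classes); (L)_t(p) is the lattice statement
`(j^*)⁻¹ N^p(X_t) ≤ N^p(𝒳) + ker j^*` of part XVII-b, i.e. `I ∩ N^p(X_t) = j^* N^p(𝒳)`. Fix a global class `K ∈ N¹(𝒳)`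
whose restriction to every fibre has the hard Lefschetz property and whose restriction `κ = j^*K` to `X_t` is a polarisation
class (§3: the rational Kähler class of a Kähler–rational datum of `𝒳` pulled back from `ℙᴺ` is such a `K`).
(Prim)_t(p) := every `κ`-PRIMITIVE class `ξ ∈ P^{2p}(X_t) ∩ N^p(X_t) ∩ I` lies in `j^* N^p(𝒳)`.

* `I` is `L`-stable (`j^*(K ∪ W) = κ ∪ j^*W`) and stable under the primitive projections `ξ_P` of the Lefschetz
  decomposition of `(X_t, κ)`: part XII-a `exists_primitivePart_map_fiberι_eq` granted Deligne's "invariant classes come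
  from the total space", which is the tree THEOREM `deligne1968_invariantClass_fromTotalSpace_holds` (Voisin II Thm. 4.18).
* The primitive components of an algebraic class of codimension `p` are algebraic as soon as the surjectivity clause of
  `A(X_t, κ)` holds below `p` (Kleiman; part XVIII-d `primitivePart_mem_supportedClasses_of_surjOn_lt`) — unconditionally
  for `p ≤ 2` (Lefschetz `(1,1)`), under the Hodge conjecture of the fibre in general (tree:
  `standardConjectureA_of_hodgeClasses_algebraic`), in particular at a CM fibre under `HC_CM` (part XXI-b).
* STEP (§1): let `ξ = j^*W ∈ N^{p+1}(X_t)`, `ξ = Σ_{a+2s=2p+2} Lˢ ξ_{(a,s)}`. The top component `ξ_{(2p+2,0)} ∈ P ∩ N ∩ I`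
  lies in `j^*N^{p+1}(𝒳)` by (Prim)_t(p+1). For `s ≥ 1`, `L^{s-1} ξ_{(a,s)} ∈ I ∩ N^p(X_t) = j^*N^p(𝒳)` by (L)_t(p), say
  `= j^*a'`, and `Lˢ ξ_{(a,s)} = κ ∪ j^*a' = j^*(K ∪ a')`, `K ∪ a' ∈ N^{p+1}(𝒳)`. Hence (L)_t(p+1).
* INDUCTION (§2): (L)_t(0), (L)_t(1) are unconditional (part XVIII-i, Lieberman); there are no primitive classes above
  the middle degree; so (L)_t(p) ⟸ ⋀_{2 ≤ r ≤ p, 2r ≤ d} (Prim)_t(r), granted `A(X_t, κ)` in the codimensions `p' < p`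
  with `2p'+1 ≤ d`. Conversely (L)_t(r) ⟹ (Prim)_t(r) trivially. In particular **(L)_t(2) ⟺ (Prim)_t(2) with no
  hypothesis at all** (§4): the first open instance of the André-axis lift (`d = 4`, degree 4, part XVIII-i) is a
  statement about the invariant PRIMITIVE middle cohomology of the abelian fourfold fibre.
  WHY THIS IS WHERE "B IS KNOWN FOR ABELIAN VARIETIES" STOPS: the coprimitive part `κ ∪ H^{2p-2}(X_t)` of an invariant
  algebraic class is handled by the divisorial lift and never meets the total space's conjecture D; what remains —
  a primitive invariant algebraic class of the fibre — must be cut out by a cycle of the NON-abelian total space `𝒳`.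

## What is proved (theorems only; no definition, no named fact, no sorry; `HC_CM` absent)

§0 `lefschetzPowTo_mem_algebraicClasses` (bookkeeping). §1 **`comap_le_sup_succ_of_primitiveLift`** (the step).
§2 `comap_le_sup_of_relDim_lt`, `mem_map_algebraicClasses_of_comap_le_sup` ((L) ⟹ (Prim)),
**`comap_le_sup_of_primitiveLift`** (induction), **`forall_comap_le_sup_iff_primitiveLift_of_standardConjectureA`**
(under `A(X_t, κ)`: lift in every degree ⟺ primitive lifts in degrees `4 ≤ 2r ≤ d`). §3
**`exists_algebraic_globalPolarization`** (a global ALGEBRAIC rational class polarising every fibre). §4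
**`comap_le_sup_two_iff_primitiveLift_two`** ((L)_t(2) ⟺ (Prim)_t(2), every `d`, every pencil, every point).

EDGE LABELS (RING2-MAP §AbelianAll gen 13): all K (kernel, no fact, no `HC_CM`); the `A`-clause is a displayed hypothesis
where present. References: Kleiman1968AlgebraicCycles (§3, proof of Prop. 3.8); Lieberman1968 (Thm. 1); Grothendieck1968
(§3 p. 196); VoisinHodgeI2002 (§6.2.3 Cor. 6.26, Lemma 6.29, Thm. 6.25, Thm. 7.10, Thm. 11.30); VoisinHodgeII2003 (Thm. 4.15,
Thm. 4.18, Prop. 9.20); Deligne1968 ((2.1), (2.6.3)); Milne2020HodgeClassesAV (Prop. 1 p. 7); Andre1996Motifs (§5.1, §6.3);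
Abdulali1994FamiliesAV (p. 1122); HatcherAT2002 (§3.2 Prop. 3.10, §3.3).
-/

noncomputable section

set_option linter.dupNamespace false

namespace Summit.HodgeConjecture.HodgeConjecture.Ring2.AbelianAll

open CategoryTheory AlgebraicGeometry
open Literature.AlgebraicGeometry Literature.AlgebraicGeometry.Motives
open Literature.AlgebraicGeometry.HodgeTheory
open Literature.AlgebraicTopology.SingularHomology (singularCohomology cupProduct cupProduct_map)
open Literature.Geometry.Kaehler (lefschetzOperator lefschetzPow HasHardLefschetzProperty)
open Summit.HodgeConjecture.HodgeConjecture.Theses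

variable {𝒳 S : SchemeOver ℂ}

/-! ## §0 Two bookkeeping lemmas -/

/-- `L_κʳ` maps `Nˡ(Y)` into `N^{l+r}(Y)` for `κ ∈ N¹(Y)` (explicit target codimension `l'`).
[cite: VoisinHodgeII2003, §9.2.4 Prop. 9.20] -/
theorem lefschetzPowTo_mem_algebraicClasses {n : ℕ} {Y : SchemeOver ℂ} (hY : IsSmoothProjective n Y)
    {κ : complexBetti Y 2} (hκ : κ ∈ algebraicClasses Y 1) {l : ℕ} {c : complexBetti Y (2 * l)}
    (hc : c ∈ algebraicClasses Y l) (r l' : ℕ) (hl' : l + r = l') (hm : 2 * l + 2 * r = 2 * l') :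
    lefschetzPowTo κ r (2 * l) (2 * l') hm c ∈ algebraicClasses Y l' := by
  subst hl'
  exact lefschetzPowTo_mem_supportedClasses hY hκ rfl hc r (2 * (l + r)) hm

/-! ## §1 THE INDUCTIVE STEP: the lift in degree `2p` and the lift of the PRIMITIVE invariant algebraic classes of
degree `2p + 2` give the lift in degree `2p + 2` -/

/-- **THE COPRIMITIVE PART OF THE LIFT IS INHERITED.** Let `f : 𝒳 ⟶ S` be a compact pencil of abelian `d`-folds, `t` a
point, `j = j_t`, and `K ∈ N¹(𝒳)` a global algebraic class whose restriction to every fibre has the hard Lefschetz property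
and whose restriction `κ = j^*K` to `X_t` is a polarisation class. Assume the surjectivity clause of `A(X_t, κ)` in the
codimensions `p' < p + 1`, `p' + (p+1) ≤ d` (unconditional for `p + 1 ≤ 2`, part XVIII-i), the lift
(L)_t(p) : `(j^*)⁻¹N^p(X_t) ≤ N^p(𝒳) + ker j^*`, and
(Prim)_t(p+1) : every `κ`-PRIMITIVE algebraic class of degree `2p+2` on `X_t` lying in `Im j^*` lies in `j^* N^{p+1}(𝒳)`.
Then (L)_t(p+1). Proof: for `ξ = j^*W ∈ N^{p+1}(X_t)` write the Lefschetz decomposition `ξ = Σ_{a+2s=2p+2} Lˢ ξ_{(a,s)}`;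
every `ξ_{(a,s)}` is in `Im j^*` (Deligne's invariant-class theorem, part XII-a `exists_primitivePart_map_fiberι_eq` with the
tree's `deligne1968_invariantClass_fromTotalSpace_holds`) and algebraic (Kleiman, part XVIII-d); the top component
`ξ_{(2p+2,0)}` lies in `j^*N^{p+1}(𝒳)` by (Prim); for `s ≥ 1`, `L^{s-1} ξ_{(a,s)} ∈ Im j^* ∩ N^p(X_t) = j^*N^p(𝒳)` by (L)_t(p),
say `= j^* a'`, and `Lˢ ξ_{(a,s)} = κ ∪ j^*a' = j^*(K ∪ a')` with `K ∪ a' ∈ N^{p+1}(𝒳)`.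
[cite: VoisinHodgeI2002, §6.2.3 Cor. 6.26] [cite: VoisinHodgeII2003, §4.3.1 Thm. 4.18] [cite: Kleiman1968AlgebraicCycles, §3 (proof of Prop. 3.8)]
[cite: Milne2020HodgeClassesAV, Prop. 1 (p. 7)] -/
theorem comap_le_sup_succ_of_primitiveLift {d : ℕ} {f : 𝒳 ⟶ S} (hf : IsCompactAbelianPencil f d)
    (t : ComplexPoints S) {K : complexBetti 𝒳 2} (hKalg : K ∈ algebraicClasses 𝒳 1)
    (hK : ∀ s : ComplexPoints S, HasHardLefschetzProperty (complexBetti.map (fiberι f s) 2 K) d)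
    (hKt : IsPolarizationClass d (fiberOver f t) (complexBetti.map (fiberι f t) 2 K)) {p : ℕ}
    (hA : ∀ (p' r' q' : ℕ), p' < p + 1 → p' + (p + 1) ≤ d → 2 * p' + r' = d → p' + r' = q' →
      Set.SurjOn (lefschetzPow (complexBetti.map (fiberι f t) 2 K) r' (2 * p'))
        (algebraicClasses (fiberOver f t) p' : Set (complexBetti (fiberOver f t) (2 * p')))
        (supportedClasses (fiberOver f t) (2 * p' + 2 * r') q'))
    (hprev : (algebraicClasses (fiberOver f t) p).comap (complexBetti.map (fiberι f t) (2 * p)).hom ≤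
      algebraicClasses 𝒳 p ⊔ LinearMap.ker (complexBetti.map (fiberι f t) (2 * p)).hom)
    (hprim : ∀ ξ ∈ algebraicClasses (fiberOver f t) (p + 1),
      ξ ∈ primitiveClasses (complexBetti.map (fiberι f t) 2 K) d (2 * (p + 1)) →
      ξ ∈ LinearMap.range (complexBetti.map (fiberι f t) (2 * (p + 1))).hom →
      ξ ∈ (algebraicClasses 𝒳 (p + 1)).map (complexBetti.map (fiberι f t) (2 * (p + 1))).hom) :
    (algebraicClasses (fiberOver f t) (p + 1)).comap (complexBetti.map (fiberι f t) (2 * (p + 1))).hom ≤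
      algebraicClasses 𝒳 (p + 1) ⊔ LinearMap.ker (complexBetti.map (fiberι f t) (2 * (p + 1))).hom := by
  classical
  have h𝒳 := hf.isSmoothProjective_total
  have hXt := hf.isSmoothProjective_fiberOver t
  set κ := complexBetti.map (fiberι f t) 2 K with hκdef
  intro W hW
  set ξ := (complexBetti.map (fiberι f t) (2 * (p + 1))).hom W with hξdef
  have hξ : ξ ∈ algebraicClasses (fiberOver f t) (p + 1) := hW
  -- it suffices to lift `ξ` into `j^* N^{p+1}(𝒳)`
  suffices hsuff : ξ ∈ (algebraicClasses 𝒳 (p + 1)).map (complexBetti.map (fiberι f t) (2 * (p + 1))).hom by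
    obtain ⟨a, ha, hja⟩ := Submodule.mem_map.1 hsuff
    rw [Submodule.mem_sup]
    refine ⟨a, ha, W - a, ?_, add_sub_cancel a W⟩
    rw [LinearMap.mem_ker, map_sub, hja, hξdef, sub_self]
  -- Lefschetz decomposition of `ξ`
  rw [← sum_lefschetzPowTo_primitivePart (hK t) (hvan_fiberOver hf t) ξ]
  refine Submodule.sum_mem _ fun P _ ↦ ?_
  -- the component `ξ_P`: primitive, algebraic, invariant
  have hPprim : primitivePart κ d (hK t) (hvan_fiberOver hf t) P ξ ∈ primitiveClasses κ d P.1.1 :=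
    primitivePart_mem (hK t) (hvan_fiberOver hf t) P ξ
  have hPalg : primitivePart κ d (hK t) (hvan_fiberOver hf t) P ξ ∈
      supportedClasses (fiberOver f t) P.1.1 (p + 1 - P.1.2) :=
    primitivePart_mem_supportedClasses_of_surjOn_lt hXt hKt.mem_algebraicClasses (hK t) (hvan_fiberOver hf t)
      (p + 1) hA ξ hξ P
  obtain ⟨B, hB⟩ : ∃ B : complexBetti 𝒳 P.1.1,
      primitivePart κ d (hK t) (hvan_fiberOver hf t) P ξ = complexBetti.map (fiberι f t) P.1.1 B :=
    exists_primitivePart_map_fiberι_eq deligne1968_invariantClass_fromTotalSpace_holds hf K hK W P t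
  obtain ⟨⟨a, s⟩, hP⟩ := P
  dsimp only at hPprim hPalg hB ⊢
  cases s with
  | zero =>
    -- the top primitive component: (Prim)
    have ha : a = 2 * (p + 1) := by omega
    subst ha
    rw [lefschetzPowTo_zero_eq_id κ, LinearMap.id_apply]
    refine hprim _ ?_ hPprim ⟨B, hB.symm⟩
    simpa using hPalg
  | succ s =>
    -- `Lˢ⁺¹ ξ_P = κ ∪ (Lˢ ξ_P)` with `Lˢ ξ_P ∈ Im j^* ∩ N^p(X_t)`
    have hm : a + 2 * s = 2 * p := by omega
    have h2 : 2 * p + 2 * 1 = 2 * (p + 1) := by ring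
    rw [← lefschetzPowTo_lefschetzPowTo κ 1 hm h2 hP]
    set η := lefschetzPowTo κ s a (2 * p) hm (primitivePart κ d (hK t) (hvan_fiberOver hf t) ⟨(a, s + 1), hP⟩ ξ)
      with hηdef
    have hηalg : η ∈ algebraicClasses (fiberOver f t) p := by
      have h := lefschetzPowTo_mem_supportedClasses hXt hKt.mem_algebraicClasses
        (show 2 * (p + 1 - (s + 1)) = a by omega) hPalg s (2 * p) hm
      rwa [show p + 1 - (s + 1) + s = p by omega] at h
    have hηB : η = complexBetti.map (fiberι f t) (2 * p) (lefschetzPowTo K s a (2 * p) hm B) := by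
      rw [hηdef, hB, map_fiberι_lefschetzPowTo t K s a (2 * p) hm B]
    -- (L)_t(p): `η = j^* a'` with `a'` algebraic
    have hcomap : lefschetzPowTo K s a (2 * p) hm B ∈
        (algebraicClasses (fiberOver f t) p).comap (complexBetti.map (fiberι f t) (2 * p)).hom := by
      rw [Submodule.mem_comap]
      change complexBetti.map (fiberι f t) (2 * p) (lefschetzPowTo K s a (2 * p) hm B) ∈ _
      rw [← hηB]
      exact hηalg
    obtain ⟨a', ha', k, hk, hak⟩ := Submodule.mem_sup.1 (hprev hcomap)
    rw [LinearMap.mem_ker] at hk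
    have hηa' : η = complexBetti.map (fiberι f t) (2 * p) a' := by
      rw [hηB, ← hak, map_add]
      change _ + (complexBetti.map (fiberι f t) (2 * p)).hom k = _
      rw [hk, add_zero]
    -- `L η = κ ∪ j^* a' = j^*(K ∪ a')`
    refine ⟨lefschetzPowTo K 1 (2 * p) (2 * (p + 1)) h2 a',
      lefschetzPowTo_mem_algebraicClasses h𝒳 hKalg ha' 1 (p + 1) rfl h2, ?_⟩
    change complexBetti.map (fiberι f t) (2 * (p + 1)) (lefschetzPowTo K 1 (2 * p) (2 * (p + 1)) h2 a') = _
    rw [map_fiberι_lefschetzPowTo t K 1 (2 * p) (2 * (p + 1)) h2 a', ← hηa']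

/-! ## §2 Induction: the lift in every degree from the lift of the primitive invariant algebraic classes -/

/-- Degrees above `2d` are vacuous for the lift (`H^{2p}(X_t(ℂ); ℂ) = 0`). [cite: HatcherAT2002, §3.3 (Prop. 3.29)] -/
theorem comap_le_sup_of_relDim_lt {d : ℕ} {f : 𝒳 ⟶ S} (hf : IsCompactAbelianPencil f d) (t : ComplexPoints S)
    {p : ℕ} (hp : d < p) :
    (algebraicClasses (fiberOver f t) p).comap (complexBetti.map (fiberι f t) (2 * p)).hom ≤
      algebraicClasses 𝒳 p ⊔ LinearMap.ker (complexBetti.map (fiberι f t) (2 * p)).hom := by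
  haveI := subsingleton_complexBetti (hf.isSmoothProjective_fiberOver t) (show 2 * d < 2 * p by omega)
  intro W _
  refine Submodule.mem_sup_right ?_
  rw [LinearMap.mem_ker]
  exact Subsingleton.elim _ _

/-- The converse bookkeeping: under (L)_t(r), EVERY algebraic class of `X_t` in `Im j_t^*` (primitive or not) lies in
`j_t^* N^r(𝒳)`. [cite: Milne2020HodgeClassesAV, Prop. 1 (p. 7)] -/
theorem mem_map_algebraicClasses_of_comap_le_sup {d : ℕ} {f : 𝒳 ⟶ S} (_hf : IsCompactAbelianPencil f d)
    (t : ComplexPoints S) {r : ℕ}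
    (hL : (algebraicClasses (fiberOver f t) r).comap (complexBetti.map (fiberι f t) (2 * r)).hom ≤
      algebraicClasses 𝒳 r ⊔ LinearMap.ker (complexBetti.map (fiberι f t) (2 * r)).hom)
    {ξ : complexBetti (fiberOver f t) (2 * r)} (hξ : ξ ∈ algebraicClasses (fiberOver f t) r)
    (hrange : ξ ∈ LinearMap.range (complexBetti.map (fiberι f t) (2 * r)).hom) :
    ξ ∈ (algebraicClasses 𝒳 r).map (complexBetti.map (fiberι f t) (2 * r)).hom := by
  obtain ⟨W, rfl⟩ := hrange
  obtain ⟨a, ha, k, hk, hak⟩ := Submodule.mem_sup.1 (hL (show W ∈ _ from hξ))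
  rw [LinearMap.mem_ker] at hk
  refine ⟨a, ha, ?_⟩
  rw [← hak, map_add, hk, add_zero]

/-- **THE LIFT IN DEGREE `2p` FROM THE PRIMITIVE LIFTS IN DEGREES `4 ≤ 2r ≤ min(2p, d)`.** For a compact pencil of abelian
`d`-folds, a point `t`, a global algebraic class `K` polarising every fibre (§4) with `κ = j_t^*K`, and `p`: granted the
surjectivity clause of `A(X_t, κ)` in the codimensions `p' < p` with `2p' + 1 ≤ d` (unconditional for `p ≤ 2`), the lift
(L)_t(p) follows from (Prim)_t(r) for `2 ≤ r ≤ p`, `2r ≤ d` — degrees `0, 2` are Lieberman's (part XVIII-i), there are no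
primitive classes above the middle degree, and everything coprimitive is inherited (§1).
[cite: VoisinHodgeI2002, §6.2.3 Cor. 6.26] [cite: Kleiman1968AlgebraicCycles, §3] [cite: Lieberman1968, Thm. 1]
[cite: Milne2020HodgeClassesAV, Prop. 1 (p. 7)] -/
theorem comap_le_sup_of_primitiveLift {d : ℕ} {f : 𝒳 ⟶ S} (hf : IsCompactAbelianPencil f d)
    (t : ComplexPoints S) {K : complexBetti 𝒳 2} (hKalg : K ∈ algebraicClasses 𝒳 1)
    (hK : ∀ s : ComplexPoints S, HasHardLefschetzProperty (complexBetti.map (fiberι f s) 2 K) d)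
    (hKt : IsPolarizationClass d (fiberOver f t) (complexBetti.map (fiberι f t) 2 K)) :
    ∀ (p : ℕ), (∀ (p' r' q' : ℕ), p' < p → 2 * p' + 1 ≤ d → 2 * p' + r' = d → p' + r' = q' →
      Set.SurjOn (lefschetzPow (complexBetti.map (fiberι f t) 2 K) r' (2 * p'))
        (algebraicClasses (fiberOver f t) p' : Set (complexBetti (fiberOver f t) (2 * p')))
        (supportedClasses (fiberOver f t) (2 * p' + 2 * r') q')) →
    (∀ r, 2 ≤ r → r ≤ p → 2 * r ≤ d → ∀ ξ ∈ algebraicClasses (fiberOver f t) r,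
      ξ ∈ primitiveClasses (complexBetti.map (fiberι f t) 2 K) d (2 * r) →
      ξ ∈ LinearMap.range (complexBetti.map (fiberι f t) (2 * r)).hom →
      ξ ∈ (algebraicClasses 𝒳 r).map (complexBetti.map (fiberι f t) (2 * r)).hom) →
    (algebraicClasses (fiberOver f t) p).comap (complexBetti.map (fiberι f t) (2 * p)).hom ≤
      algebraicClasses 𝒳 p ⊔ LinearMap.ker (complexBetti.map (fiberι f t) (2 * p)).hom
  | 0, _, _ => by
    exact comap_le_sup_of_extreme hf t (show 0 + d = d by omega) (Or.inl (by omega))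
  | p + 1, hA, hPrim => by
    have hXt := hf.isSmoothProjective_fiberOver t
    rcases Nat.lt_or_ge d (p + 1) with hpd | hpd
    · exact comap_le_sup_of_relDim_lt hf t hpd
    rcases Nat.lt_or_ge p 1 with hp1 | hp1
    · obtain rfl : p = 0 := by omega
      exact comap_le_sup_of_extreme hf t (show 1 + (d - 1) = d by omega) (Or.inl le_rfl)
    refine comap_le_sup_succ_of_primitiveLift hf t hKalg hK hKt (fun p' r' q' h1 h2 h3 h4 ↦ ?_)
      (comap_le_sup_of_primitiveLift hf t hKalg hK hKt p (fun p' r' q' h1 h2 h3 h4 ↦ hA p' r' q' (by omega) h2 h3 h4)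
        (fun r h2r hrp h2rd ↦ hPrim r h2r (by omega) h2rd)) ?_
    · rcases Nat.lt_or_ge p' 2 with hp' | hp'
      · exact surjOn_lefschetzPow_algebraicClasses_of_le_one hXt hKt (by omega) h3 h4
      · exact hA p' r' q' h1 (by omega) h3 h4
    · by_cases h2d : 2 * (p + 1) ≤ d
      · exact hPrim (p + 1) (by omega) le_rfl h2d
      · intro ξ _ hξprim _
        rw [primitiveClasses_eq_bot_of_lt _ d (show d < 2 * (p + 1) by omega), Submodule.mem_bot] at hξprim
        rw [hξprim]
        exact Submodule.zero_mem _

/-- **Under `A(X_t, κ)` (all codimensions): the lift in EVERY degree ⟺ the primitive lifts in degrees `4 ≤ 2r ≤ d`.**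
[cite: Kleiman1968AlgebraicCycles, §3] [cite: Grothendieck1968, §3 p. 196 (A(X))] [cite: Milne2020HodgeClassesAV, Prop. 1 (p. 7)] -/
theorem forall_comap_le_sup_iff_primitiveLift_of_standardConjectureA {d : ℕ} {f : 𝒳 ⟶ S}
    (hf : IsCompactAbelianPencil f d) (t : ComplexPoints S) {K : complexBetti 𝒳 2}
    (hKalg : K ∈ algebraicClasses 𝒳 1)
    (hK : ∀ s : ComplexPoints S, HasHardLefschetzProperty (complexBetti.map (fiberι f s) 2 K) d)
    (hKt : IsPolarizationClass d (fiberOver f t) (complexBetti.map (fiberι f t) 2 K))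
    (hAt : StandardConjectureA d (fiberOver f t) (complexBetti.map (fiberι f t) 2 K)) :
    (∀ p : ℕ, (algebraicClasses (fiberOver f t) p).comap (complexBetti.map (fiberι f t) (2 * p)).hom ≤
      algebraicClasses 𝒳 p ⊔ LinearMap.ker (complexBetti.map (fiberι f t) (2 * p)).hom) ↔
    ∀ r, 2 ≤ r → 2 * r ≤ d → ∀ ξ ∈ algebraicClasses (fiberOver f t) r,
      ξ ∈ primitiveClasses (complexBetti.map (fiberι f t) 2 K) d (2 * r) →
      ξ ∈ LinearMap.range (complexBetti.map (fiberι f t) (2 * r)).hom →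
      ξ ∈ (algebraicClasses 𝒳 r).map (complexBetti.map (fiberι f t) (2 * r)).hom := by
  refine ⟨fun h r _ _ ξ hξ _ hrange ↦ mem_map_algebraicClasses_of_comap_le_sup hf t (h r) hξ hrange,
    fun h p ↦ comap_le_sup_of_primitiveLift hf t hKalg hK hKt p
      (fun p' r' q' _ _ h3 h4 ↦ (hAt.2 p' r' q' h3 h4).surjOn) (fun r h2 _ h2d ↦ h r h2 h2d)⟩

/-! ## §3 A global algebraic class polarising every fibre exists -/

/-- **One global ALGEBRAIC class polarising every fibre.** For a compact pencil `f : 𝒳 ⟶ S` of abelian `d`-folds there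
is `K ∈ N¹(𝒳)`, rational, whose restriction to EVERY fibre is a polarisation class (rational, algebraic, hard Lefschetz in
dimension `d`): the rational Kähler class of a Kähler–rational datum of `𝒳` pulled back from `ℙᴺ` along a projective
embedding `ε` (`exists_kaehlerRationalDatum_eq_map`; algebraic by Lefschetz `(1,1)`), whose generator of `H²(ℙᴺ(ℂ); ℂ)`
restricts with hard Lefschetz to every smooth closed subvariety (`hasHardLefschetzProperty_map_of_forall_eq_smul`); for
`d = 0` the class `0` serves. (Part XII-a's `exists_globalKaehlerClass` gives hard Lefschetz on the fibres but does not
record algebraicity on `𝒳`.) [cite: VoisinHodgeII2003, §4.2.3 Thm. 4.15] [cite: VoisinHodgeI2002, Thm. 6.25, Thm. 7.10 and Thm. 11.30] -/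
theorem exists_algebraic_globalPolarization {d : ℕ} {f : 𝒳 ⟶ S} (hf : IsCompactAbelianPencil f d) :
    ∃ K : complexBetti 𝒳 2, K ∈ algebraicClasses 𝒳 1 ∧ IsRationalClass K ∧
      ∀ s : ComplexPoints S, IsPolarizationClass d (fiberOver f s) (complexBetti.map (fiberι f s) 2 K) := by
  have h𝒳 := hf.isSmoothProjective_total
  -- restrictions of algebraic / rational classes
  have hres : ∀ (K : complexBetti 𝒳 2), K ∈ algebraicClasses 𝒳 1 → IsRationalClass K →
      (∀ s : ComplexPoints S, HasHardLefschetzProperty (complexBetti.map (fiberι f s) 2 K) d) →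
      ∀ s : ComplexPoints S, IsPolarizationClass d (fiberOver f s) (complexBetti.map (fiberι f s) 2 K) := by
    intro K hKalg hKrat hK s
    refine ⟨hKrat.map _, ?_, hK s⟩
    exact algebraicClasses_sup_ker_le_comap hf 1 s (Submodule.mem_sup_left hKalg)
  rcases Nat.eq_zero_or_pos d with rfl | hd
  · refine ⟨0, Submodule.zero_mem _, IsRationalClass.zero, hres 0 (Submodule.zero_mem _) IsRationalClass.zero ?_⟩
    intro s j k hjk
    obtain ⟨rfl, rfl⟩ : j = 0 ∧ k = 0 := by omega
    exact Function.bijective_id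
  obtain ⟨N, ε, hε⟩ := h𝒳.isProjectiveOver
  haveI := hε
  obtain ⟨D, c, hc⟩ := exists_kaehlerRationalDatum_eq_map h𝒳 ε
  have hpol : IsPolarizationClass (d + 1) 𝒳 D.Hη := isPolarizationClass_Hη h𝒳 D
  refine ⟨D.Hη, hpol.mem_algebraicClasses, hpol.isRationalClass,
    hres _ hpol.mem_algebraicClasses hpol.isRationalClass fun s ↦ ?_⟩
  -- `c ≠ 0`: otherwise `D.Hη = 0`, and hard Lefschetz on `𝒳` would force `H^{2d+2}(𝒳(ℂ); ℂ) = 0`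
  obtain ⟨t⟩ : Nonempty (ComplexPoints S) := ⟨s⟩
  have hc0 : c ≠ 0 := by
    intro h0
    have hK0 : D.Hη = 0 := by rw [hc, h0, map_zero]
    obtain ⟨x, hx⟩ := exists_fiberGysin_map_fiberι_top_ne_zero hf t
    have hbij := bijective_lefschetzPowTo_of_hasHardLefschetz D.Hη (D.hLℂ h𝒳)
      (show 0 + (d + 1) = d + 1 by omega) (2 * (d + 1)) (by omega)
    obtain ⟨y, hy⟩ := hbij.2 (fiberGysin hf t d (complexBetti.map (fiberι f t) (2 * d) x))
    apply hx
    rw [← hy, lefschetzPowTo_succ_apply D.Hη d 0 (0 + 2 * d) (2 * (d + 1)) rfl (by omega) (by omega), hK0,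
      Literature.Geometry.Kaehler.lefschetzOperator_apply, LinearMap.map_zero, LinearMap.zero_apply]
  -- `c` spans `H²(ℙᴺ(ℂ); ℂ)`
  obtain ⟨r₀, -, hr₀⟩ := exists_isRationalClass_forall_eq_smul_projectiveSpace N
  obtain ⟨z, hz⟩ := hr₀ c
  have hz0 : z ≠ 0 := by
    rintro rfl
    exact hc0 (by rw [hz, zero_smul])
  have hgen : ∀ c' : complexBetti (projectiveSpace N ℂ) 2, ∃ w : ℂ, c' = w • c := fun c' ↦ by
    obtain ⟨z', hz'⟩ := hr₀ c'
    exact ⟨z' * z⁻¹, by rw [hz', hz, smul_smul, mul_assoc, inv_mul_cancel₀ hz0, mul_one]⟩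
  -- the fibre embeds in `ℙᴺ` through `ε`
  haveI : IsProper S.hom := IsSmoothProjective.isProper_holds hf.isSmoothProjective_base
  haveI : IsProper f.left := hf.isSmoothProjectiveFamily.isProper
  haveI : IsClosedImmersion (fiberι f s ≫ ε).left := isClosedImmersion_fiberι_comp_left_of_isPreimmersion f ε s
  have hHL := hasHardLefschetzProperty_map_of_forall_eq_smul (hf.isSmoothProjective_fiberOver s) (fiberι f s ≫ ε) hgen
  have e : complexBetti.map (fiberι f s) 2 D.Hη = complexBetti.map (fiberι f s ≫ ε) 2 c := by
    rw [hc, complexBetti.map_comp, CategoryTheory.comp_apply]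
  rw [e]
  exact hHL

/-! ## §4 Degree four: the lift of the `(2,2)`-classes is EXACTLY the primitive lift, on every pencil; `d = 4` -/

/-- **(L)_t(2) ⟺ (Prim)_t(2), UNCONDITIONALLY, on every compact pencil of abelian varieties and at every point**: an
invariant algebraic class of degree `4` on `X_t` lifts to an algebraic class of `𝒳` iff its `κ`-primitive part does (the
coprimitive part `κ ∪ H²` is carried by the divisorial lift, part XVIII-i; Kleiman's components in codimension `2` need only
Lefschetz `(1,1)`). [cite: Lieberman1968, Thm. 1] [cite: Kleiman1968AlgebraicCycles, §3] [cite: VoisinHodgeI2002, §6.2.3 Cor. 6.26] -/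
theorem comap_le_sup_two_iff_primitiveLift_two {d : ℕ} {f : 𝒳 ⟶ S} (hf : IsCompactAbelianPencil f d)
    (t : ComplexPoints S) {K : complexBetti 𝒳 2} (hKalg : K ∈ algebraicClasses 𝒳 1)
    (hK : ∀ s : ComplexPoints S, HasHardLefschetzProperty (complexBetti.map (fiberι f s) 2 K) d)
    (hKt : IsPolarizationClass d (fiberOver f t) (complexBetti.map (fiberι f t) 2 K)) :
    (algebraicClasses (fiberOver f t) 2).comap (complexBetti.map (fiberι f t) (2 * 2)).hom ≤
      algebraicClasses 𝒳 2 ⊔ LinearMap.ker (complexBetti.map (fiberι f t) (2 * 2)).hom ↔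
    ∀ ξ ∈ algebraicClasses (fiberOver f t) 2,
      ξ ∈ primitiveClasses (complexBetti.map (fiberι f t) 2 K) d (2 * 2) →
      ξ ∈ LinearMap.range (complexBetti.map (fiberι f t) (2 * 2)).hom →
      ξ ∈ (algebraicClasses 𝒳 2).map (complexBetti.map (fiberι f t) (2 * 2)).hom := by
  refine ⟨fun h ξ hξ _ hrange ↦ mem_map_algebraicClasses_of_comap_le_sup hf t h hξ hrange, fun h ↦ ?_⟩
  refine comap_le_sup_of_primitiveLift hf t hKalg hK hKt 2 (fun p' r' q' h1 _ h3 h4 ↦ ?_) (fun r h2 h2' _ ↦ ?_)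
  · exact surjOn_lefschetzPow_algebraicClasses_of_le_one (hf.isSmoothProjective_fiberOver t) hKt (by omega) h3 h4
  · obtain rfl : r = 2 := le_antisymm h2' h2
    exact h


end Summit.HodgeConjecture.HodgeConjecture.Ring2.AbelianAll

end
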